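import Mathlib
import Summits.MatrixMultiplication.MatrixMultiplication.Theorems.LevelGradedCohnUmansLevelOneGL2DesignsTraceZeroLift
import Summits.MatrixMultiplication.MatrixMultiplication.Theorems.LevelGradedCohnUmansLevelOneGL2DesignsRealLiftNoWrap

/-!
# The abstract trace-zero parabola lift, II: boxes in an integral basis and the exponent
`3/2 - 1/[K:ℚ]` for EVERY totally real field (crux `LevelOneGL2Designs`,
stmt-MatrixMultiplication-14080, wall stub `stub_tangencySets`; wall-breaker axis k8/12
"parabola lifts over finite fields")

The companion file `…TraceZeroLift.lean` proves the registered stub `traceZeroLift`: for a totally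
real `K`, a ring map `φ : 𝓞 K → ZMod p`, and finite `X, A ⊆ 𝓞 K` with `A` trace-zero and the three
differences `(x'-x)² - (a-a')`, `x'-x`, `a-a'` of absolute norm `< p`, the reduced parabola flags of
`X × A` form a strong representative system of `AG(2,p)` with `|X|·|A| ≤ |S| + p`.  Here we supply
the parameter sets for an ARBITRARY totally real field, i.e. Pohoata's Proposition 5.1
(arXiv:2607.20422) in full generality, with no explicit basis, cyclotomic or otherwise:

* `X` = the box `{Σ_i m_i b_i : |m_i| ≤ M}` in Mathlib's integral basis `b = RingOfIntegers.basis K`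
  (`(2M+1)^d` elements, `d = [K:ℚ]`);
* `A` = the box of side `M²` in the rank-`(d-1)` trace-zero sublattice spanned by
  `τ_{i₀} b_i - τ_i b_{i₀}` (`τ_i = Tr b_i`, `i₀` a basis index with `τ_{i₀} ≠ 0`, which exists because
  `Tr 1 = d ≠ 0`): coordinates `j ↦ τ_{i₀} n_j - [j = i₀] Σ_i τ_i n_i` with `n_{i₀} = 0`
  (`(2M²+1)^{d-1}` elements, trace `Σ_j (…)_j τ_j = 0` identically — `sum_tzCoeff_mul`);
* every conjugate of a `ℤ`-combination with coefficients `≤ V` has modulus `≤ V · C_K`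
  (`exists_embedding_bound`), so the three differences have all conjugates `≤ M² · C₁(K)` and
  absolute norm `≤ (M² C₁)^d < p` as soon as `C₁^d · M^{2d} < p` (`RealLift.natAbs_norm_le_pow`).

Results (namespace `…LevelOneGL2Designs.TraceZeroLift`):

* `traceZeroLift_boxes` : `∃ C = C(K) > 0, ∀ p, ∀ φ : 𝓞 K →+* ZMod p, ∀ M, C·M^{2d} < p →` an SRS
  `S` in the format of `stub_tangencySets` with `(2M+1)^d (2M²+1)^{d-1} ≤ |S| + p`;
* (companion file `…TraceZeroLiftExponent.lean`) `traceZeroLift_exponent` : `d ≥ 3 ⇒ ∃ c > 0,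
  ∃ p₁, ∀ primes p ≥ p₁` admitting a ring map `𝓞 K → ZMod p` (a residue-degree-one prime), an SRS
  with `≥ c · p^{3/2 - 1/d}` flags (`M = ⌊(p/2C)^{1/(2d)}⌋`).

What this does NOT do: reach the stub's exponent `3/2`.  Every number-field box lift loses the
factor `p^{1/d}` to the trace condition (one codimension at the top scale), and letting `d` grow
with `p` costs `rd_K^{Θ(d)}`; the stub itself (`c · p^{3/2}` over prime fields) remains the open
frontier (see the AXIS notes of the k8/k11 seats in `Cruxes/LevelOneGL2Designs/`).

References: C. Pohoata, *The sharp exponent for the minimal distance problem*, arXiv:2607.20422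
(2026), Proposition 5.1 and the proof of Theorem 1.3 [bib: Pohoata2026SharpExponentMinimalDistance].
-/

-- justification: the summit/problem path `MatrixMultiplication.MatrixMultiplication` is fixed by the
-- tree layout (D-0017), so the namespace necessarily repeats a component.
set_option linter.dupNamespace false

noncomputable section

open NumberField Module Finset Matrix

namespace Summit.MatrixMultiplication.MatrixMultiplication.Theorems.LevelOneGL2Designs.TraceZeroLift

variable (K : Type*) [Field K] [NumberField K]

/-- The index set of Mathlib's integral basis of `𝓞 K` has `[K:ℚ]` elements. [elementary] -/
theorem card_basisIndex :
    Fintype.card (Free.ChooseBasisIndex ℤ (𝓞 K)) = finrank ℚ K := by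
  rw [← finrank_eq_card_chooseBasisIndex, RingOfIntegers.rank]

/-- Some member of the integral basis has non-zero trace (the traces of the basis cannot all
vanish, since `Tr(1) = [K:ℚ] ≠ 0`). [elementary] -/
theorem exists_trace_basis_ne_zero :
    ∃ i, Algebra.trace ℤ (𝓞 K) (RingOfIntegers.basis K i) ≠ 0 := by
  by_contra h
  push Not at h
  have h1 : Algebra.trace ℤ (𝓞 K) 1 = (finrank ℤ (𝓞 K) : ℤ) := by
    have := Algebra.trace_algebraMap (R := ℤ) (S := 𝓞 K) 1
    simpa using this
  have h2 : Algebra.trace ℤ (𝓞 K) 1 = 0 := by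
    rw [← (RingOfIntegers.basis K).sum_repr 1, map_sum]
    exact Finset.sum_eq_zero fun i _ => by rw [map_zsmul, h i, smul_zero]
  have h3 : 0 < finrank ℤ (𝓞 K) := by rw [RingOfIntegers.rank]; exact finrank_pos
  omega

/-- The trace of an integer combination of the integral basis. [elementary] -/
theorem trace_equivFun_symm (v : Free.ChooseBasisIndex ℤ (𝓞 K) → ℤ) :
    Algebra.trace ℤ (𝓞 K) ((RingOfIntegers.basis K).equivFun.symm v) =
      ∑ i, v i * Algebra.trace ℤ (𝓞 K) (RingOfIntegers.basis K i) := by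
  rw [Basis.equivFun_symm_apply, map_sum]
  exact Finset.sum_congr rfl fun i _ => by rw [map_zsmul, smul_eq_mul]

/-- **Archimedean size of integer combinations of the integral basis.**  There is a constant
`C = C(K) ≥ 0` such that every `ℤ`-combination of the integral basis with coefficients of absolute
value `≤ V` has all its complex conjugates of modulus `≤ V · C`. [elementary] -/
theorem exists_embedding_bound :
    ∃ C : ℝ, 0 ≤ C ∧ ∀ (σ : K →ₐ[ℚ] ℂ) (v : Free.ChooseBasisIndex ℤ (𝓞 K) → ℤ) (V : ℝ),
      (∀ i, |(v i : ℝ)| ≤ V) →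
      ‖σ (((RingOfIntegers.basis K).equivFun.symm v : 𝓞 K) : K)‖ ≤ V * C := by
  set b := RingOfIntegers.basis K with hb
  refine ⟨∑ i, ∑ σ : K →ₐ[ℚ] ℂ, ‖σ (b i : K)‖, by positivity, fun σ v V hv => ?_⟩
  have hV : 0 ≤ V := le_trans (abs_nonneg _) (hv (Classical.arbitrary _))
  have hexp : σ (((b.equivFun.symm v : 𝓞 K)) : K) = ∑ i, (v i : ℂ) * σ (b i : K) := by
    rw [Basis.equivFun_symm_apply]
    push_cast
    rw [map_sum]
    refine Finset.sum_congr rfl fun i _ => ?_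
    rw [zsmul_eq_mul, map_mul, map_intCast]
  rw [hexp, Finset.mul_sum]
  refine (norm_sum_le _ _).trans (Finset.sum_le_sum fun i _ => ?_)
  rw [norm_mul, Complex.norm_intCast]
  have h1 : ‖σ (b i : K)‖ ≤ ∑ σ' : K →ₐ[ℚ] ℂ, ‖σ' (b i : K)‖ :=
    Finset.single_le_sum (f := fun σ' : K →ₐ[ℚ] ℂ => ‖σ' (b i : K)‖) (fun _ _ => norm_nonneg _)
      (Finset.mem_univ σ)
  have h2 : |(v i : ℝ)| ≤ V := hv i
  exact mul_le_mul h2 h1 (norm_nonneg _) hV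

/-- **Trace-zero coefficient vectors.**  With `τ i = Tr(b i)` and a pivot `i₀`, the vector
`j ↦ τ i₀ · n j − [j = i₀] · Σ_i τ i · n i` has `Σ_j (…)_j · τ j = 0`; these are the coordinates of
the trace-zero elements `τ i₀ · y − Tr(y) · b i₀`, `y = Σ n_i b_i`. [elementary] -/
theorem sum_tzCoeff_mul {ι : Type*} [Fintype ι] [DecidableEq ι] (τ n : ι → ℤ) (i₀ : ι) :
    ∑ j, (τ i₀ * n j - if j = i₀ then ∑ i, τ i * n i else 0) * τ j = 0 := by
  simp only [sub_mul, Finset.sum_sub_distrib, ite_mul, zero_mul, Finset.sum_ite_eq',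
    Finset.mem_univ, if_true]
  rw [Finset.sum_mul, sub_eq_zero]
  refine Finset.sum_congr rfl fun j _ => by ring

/-- The trace-zero coefficient map is injective on vectors vanishing at the pivot, provided
`τ i₀ ≠ 0`. [elementary] -/
theorem tzCoeff_injOn {ι : Type*} [Fintype ι] [DecidableEq ι] (τ : ι → ℤ) (i₀ : ι)
    (hτ : τ i₀ ≠ 0) {n n' : ι → ℤ} (hn : n i₀ = 0) (hn' : n' i₀ = 0)
    (h : (fun j => τ i₀ * n j - if j = i₀ then ∑ i, τ i * n i else 0) =
      fun j => τ i₀ * n' j - if j = i₀ then ∑ i, τ i * n' i else 0) : n = n' := by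
  funext j
  by_cases hj : j = i₀
  · rw [hj, hn, hn']
  · have := congrFun h j
    simp only [hj, if_false, sub_zero] at this
    exact mul_left_cancel₀ hτ this

/-- Coefficient bound for the trace-zero vectors: `|n i| ≤ R` for all `i` gives coordinates of
absolute value `≤ R · (2 Σ_i |τ i|)`. [elementary] -/
theorem abs_tzCoeff_le {ι : Type*} [Fintype ι] [DecidableEq ι] (τ n : ι → ℤ) (i₀ : ι) {R : ℝ}
    (hn : ∀ i, |(n i : ℝ)| ≤ R) (j : ι) :
    |((τ i₀ * n j - if j = i₀ then ∑ i, τ i * n i else 0 : ℤ) : ℝ)| ≤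
      R * (2 * ∑ i, |(τ i : ℝ)|) := by
  have hR : 0 ≤ R := le_trans (abs_nonneg _) (hn j)
  have h1 : |((τ i₀ * n j : ℤ) : ℝ)| ≤ R * ∑ i, |(τ i : ℝ)| := by
    push_cast
    rw [abs_mul, mul_comm]
    refine mul_le_mul (hn j) ?_ (abs_nonneg _) hR
    exact Finset.single_le_sum (f := fun i => |(τ i : ℝ)|) (fun _ _ => abs_nonneg _)
      (Finset.mem_univ i₀)
  have h2 : |((if j = i₀ then ∑ i, τ i * n i else 0 : ℤ) : ℝ)| ≤ R * ∑ i, |(τ i : ℝ)| := by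
    split_ifs
    · push_cast
      refine (Finset.abs_sum_le_sum_abs _ _).trans ?_
      rw [Finset.mul_sum]
      refine Finset.sum_le_sum fun i _ => ?_
      rw [abs_mul, mul_comm R]
      exact mul_le_mul_of_nonneg_left (hn i) (abs_nonneg _)
    · simp only [Int.cast_zero, abs_zero]
      positivity
  calc |((τ i₀ * n j - if j = i₀ then ∑ i, τ i * n i else 0 : ℤ) : ℝ)|
      = |((τ i₀ * n j : ℤ) : ℝ) - ((if j = i₀ then ∑ i, τ i * n i else 0 : ℤ) : ℝ)| := by
        push_cast; rfl
    _ ≤ |((τ i₀ * n j : ℤ) : ℝ)| + |((if j = i₀ then ∑ i, τ i * n i else 0 : ℤ) : ℝ)| :=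
        abs_sub _ _
    _ ≤ R * ∑ i, |(τ i : ℝ)| + R * ∑ i, |(τ i : ℝ)| := add_le_add h1 h2
    _ = R * (2 * ∑ i, |(τ i : ℝ)|) := by ring

/-- Norm control: an algebraic integer all of whose conjugates have modulus `≤ B` with
`B^{[K:ℚ]} < p` has `|N_{K/ℚ}| < p`. [elementary] -/
theorem natAbs_norm_lt_of_forall_le {p : ℕ} (w : 𝓞 K) {B : ℝ}
    (hB : ∀ σ : K →ₐ[ℚ] ℂ, ‖σ (w : K)‖ ≤ B) (hp : B ^ finrank ℚ K < p) :
    (Algebra.norm ℤ w).natAbs < p := by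
  have h := RealLift.natAbs_norm_le_pow w hB
  exact_mod_cast h.trans_lt hp

/-- **Pohoata's Proposition 5.1 for an arbitrary totally real field — box form.**  Let `K` be a
totally real number field of degree `d`.  There is a constant `C = C(K) > 0` such that for every
prime `p`, every ring map `φ : 𝓞 K → ZMod p` (i.e. every prime of `K` of residue degree one above
`p`) and every `M` with `C · M^{2d} < p`, the affine plane over `ZMod p` carries a strong
representative system `S` (format of `stub_tangencySets`) with
`(2M+1)^d (2M²+1)^{d-1} ≤ |S| + p`: reduce the parabola flags of `X × A`, `X` the box of side `M`
in an integral basis and `A` the box of side `M²` in the trace-zero sublattice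
`{τ_{i₀} y - Tr(y) b_{i₀}}`. [cite: Pohoata2026SharpExponentMinimalDistance, Proposition 5.1] -/
theorem traceZeroLift_boxes (K : Type*) [Field K] [NumberField K] [IsTotallyReal K] :
    ∃ C : ℝ, 0 < C ∧ ∀ (p : ℕ) [Fact p.Prime] (φ : 𝓞 K →+* ZMod p) (M : ℕ),
      C * (M : ℝ) ^ (2 * Module.finrank ℚ K) < p →
      ∃ S : Finset ((Fin 2 → ZMod p) × (Fin 2 → ZMod p)),
        (2 * M + 1) ^ Module.finrank ℚ K * (2 * M ^ 2 + 1) ^ (Module.finrank ℚ K - 1) ≤ S.card + p ∧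
        ∀ f ∈ S, ∀ f' ∈ S, (dotProduct f.1 f'.2 = 1 ↔ f = f') := by
  classical
  set b := RingOfIntegers.basis K with hb
  set d := finrank ℚ K with hd
  obtain ⟨C₀, hC₀, hemb⟩ := exists_embedding_bound K
  obtain ⟨i₀, hi₀⟩ := exists_trace_basis_ne_zero K
  set τ : Free.ChooseBasisIndex ℤ (𝓞 K) → ℤ := fun i => Algebra.trace ℤ (𝓞 K) (b i) with hτ
  have hτ₀ : τ i₀ ≠ 0 := hi₀
  set T : ℝ := 2 * ∑ i, |(τ i : ℝ)| with hT
  have hT0 : 0 ≤ T := by positivity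
  set C₁ : ℝ := 4 * C₀ ^ 2 + 2 * T * C₀ + 2 * C₀ + 1 with hC₁
  have hC₁0 : 0 < C₁ := by positivity
  refine ⟨C₁ ^ d, by positivity, fun p _ φ M hM => ?_⟩
  -- the trace-zero coefficient map and its linearity
  set tz : (Free.ChooseBasisIndex ℤ (𝓞 K) → ℤ) → (Free.ChooseBasisIndex ℤ (𝓞 K) → ℤ) :=
    fun n j => τ i₀ * n j - if j = i₀ then ∑ i, τ i * n i else 0 with htz
  have htz_sub : ∀ n n', tz n - tz n' = tz (n - n') := by
    intro n n'
    funext j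
    simp only [htz, Pi.sub_apply, mul_sub, Finset.sum_sub_distrib]
    split_ifs <;> ring
  -- the parameter boxes
  set box : Finset (Free.ChooseBasisIndex ℤ (𝓞 K) → ℤ) :=
    Fintype.piFinset fun _ => Finset.Icc (-(M : ℤ)) M with hbox_def
  set boxZ : Finset (Free.ChooseBasisIndex ℤ (𝓞 K) → ℤ) :=
    Fintype.piFinset fun j => if j = i₀ then {0} else Finset.Icc (-((M : ℤ) ^ 2)) ((M : ℤ) ^ 2)
    with hboxZ_def
  have hbox : ∀ m ∈ box, ∀ i, |(m i : ℝ)| ≤ M := by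
    intro m hm i
    have h := Fintype.mem_piFinset.mp hm i
    rw [Finset.mem_Icc] at h
    rw [← Int.cast_abs]
    exact_mod_cast abs_le.mpr h
  have hboxZ : ∀ n ∈ boxZ, n i₀ = 0 ∧ ∀ i, |(n i : ℝ)| ≤ (M : ℝ) ^ 2 := by
    intro n hn
    have h := Fintype.mem_piFinset.mp hn
    have h0 : n i₀ = 0 := by simpa using h i₀
    refine ⟨h0, fun i => ?_⟩
    by_cases hi : i = i₀
    · rw [hi, h0]; simp
    · have h' := h i
      rw [if_neg hi, Finset.mem_Icc] at h'
      rw [← Int.cast_abs]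
      exact_mod_cast abs_le.mpr h'
  -- cardinalities of the boxes
  have hcard_box : box.card = (2 * M + 1) ^ d := by
    rw [hbox_def, Fintype.card_piFinset, Finset.prod_const, Finset.card_univ, card_basisIndex]
    congr 1
    have : (M : ℤ) + 1 - -(M : ℤ) = ((2 * M + 1 : ℕ) : ℤ) := by push_cast; ring
    rw [Int.card_Icc, this, Int.toNat_natCast]
  have hcard_boxZ : boxZ.card = (2 * M ^ 2 + 1) ^ (d - 1) := by
    rw [hboxZ_def, Fintype.card_piFinset, ← Finset.mul_prod_erase Finset.univ _ (Finset.mem_univ i₀)]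
    rw [if_pos rfl, Finset.card_singleton, one_mul]
    rw [Finset.prod_congr rfl fun j hj => by rw [if_neg (Finset.ne_of_mem_erase hj)]]
    rw [Finset.prod_const, Finset.card_erase_of_mem (Finset.mem_univ _), Finset.card_univ,
      card_basisIndex]
    congr 1
    have : (M : ℤ) ^ 2 + 1 - -((M : ℤ) ^ 2) = ((2 * M ^ 2 + 1 : ℕ) : ℤ) := by push_cast; ring
    rw [Int.card_Icc, this, Int.toNat_natCast]
  -- the parameter sets in `𝓞 K`
  set X : Finset (𝓞 K) := box.image fun m => b.equivFun.symm m with hX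
  set A : Finset (𝓞 K) := boxZ.image fun n => b.equivFun.symm (tz n) with hA_def
  have hcardX : X.card = (2 * M + 1) ^ d := by
    rw [hX, Finset.card_image_of_injective _ b.equivFun.symm.injective, hcard_box]
  have hcardA : A.card = (2 * M ^ 2 + 1) ^ (d - 1) := by
    rw [hA_def, Finset.card_image_of_injOn, hcard_boxZ]
    intro n hn n' hn' h
    have h' : tz n = tz n' := b.equivFun.symm.injective h
    exact tzCoeff_injOn τ i₀ hτ₀ (hboxZ n hn).1 (hboxZ n' hn').1 h'
  -- trace zero
  have hA : ∀ a ∈ A, Algebra.trace ℚ K (a : K) = 0 := by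
    intro a ha
    obtain ⟨n, -, rfl⟩ := Finset.mem_image.mp ha
    rw [← Algebra.coe_trace_int, trace_equivFun_symm]
    have : ∑ j, tz n j * τ j = 0 := sum_tzCoeff_mul τ n i₀
    rw [this, Int.cast_zero]
  -- archimedean bounds on the three differences
  have hMM : (M : ℝ) ≤ (M : ℝ) ^ 2 := by exact_mod_cast Nat.le_self_pow two_ne_zero M
  have hM0 : (0 : ℝ) ≤ M := Nat.cast_nonneg M
  have hXdiff : ∀ m ∈ box, ∀ m' ∈ box, ∀ σ : K →ₐ[ℚ] ℂ,
      ‖σ ((b.equivFun.symm m' - b.equivFun.symm m : 𝓞 K) : K)‖ ≤ 2 * M * C₀ := by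
    intro m hm m' hm' σ
    rw [← map_sub b.equivFun.symm]
    refine hemb σ (m' - m) (2 * M) fun i => ?_
    rw [Pi.sub_apply, Int.cast_sub]
    calc |(m' i : ℝ) - m i| ≤ |(m' i : ℝ)| + |(m i : ℝ)| := abs_sub _ _
      _ ≤ M + M := add_le_add (hbox m' hm' i) (hbox m hm i)
      _ = 2 * M := by ring
  have hAdiff : ∀ n ∈ boxZ, ∀ n' ∈ boxZ, ∀ σ : K →ₐ[ℚ] ℂ,
      ‖σ ((b.equivFun.symm (tz n) - b.equivFun.symm (tz n') : 𝓞 K) : K)‖ ≤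
        2 * M ^ 2 * T * C₀ := by
    intro n hn n' hn' σ
    rw [← map_sub b.equivFun.symm, htz_sub]
    refine hemb σ (tz (n - n')) (2 * M ^ 2 * T) fun j => ?_
    have hR : ∀ i, |((n - n') i : ℝ)| ≤ 2 * (M : ℝ) ^ 2 := by
      intro i
      rw [Pi.sub_apply, Int.cast_sub]
      calc |(n i : ℝ) - n' i| ≤ |(n i : ℝ)| + |(n' i : ℝ)| := abs_sub _ _
        _ ≤ (M : ℝ) ^ 2 + (M : ℝ) ^ 2 := add_le_add ((hboxZ n hn).2 i) ((hboxZ n' hn').2 i)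
        _ = 2 * (M : ℝ) ^ 2 := by ring
    have := abs_tzCoeff_le τ (n - n') i₀ hR j
    simpa only [htz, hT, mul_assoc] using this
  -- the norm windows
  have hwin : ((M : ℝ) ^ 2 * C₁) ^ d < p := by
    rw [mul_pow, ← pow_mul, mul_comm]; exact hM
  have hN : ∀ x ∈ X, ∀ x' ∈ X, ∀ a ∈ A, ∀ a' ∈ A,
      (Algebra.norm ℤ ((x' - x) ^ 2 - (a - a'))).natAbs < p ∧
      (Algebra.norm ℤ (x' - x)).natAbs < p ∧ (Algebra.norm ℤ (a - a')).natAbs < p := by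
    intro x hx x' hx' a ha a' ha'
    obtain ⟨m, hm, rfl⟩ := Finset.mem_image.mp hx
    obtain ⟨m', hm', rfl⟩ := Finset.mem_image.mp hx'
    obtain ⟨n, hn, rfl⟩ := Finset.mem_image.mp ha
    obtain ⟨n', hn', rfl⟩ := Finset.mem_image.mp ha'
    set u : 𝓞 K := b.equivFun.symm m' - b.equivFun.symm m with hu
    set v : 𝓞 K := b.equivFun.symm (tz n) - b.equivFun.symm (tz n') with hv
    have hu1 : ∀ σ : K →ₐ[ℚ] ℂ, ‖σ (u : K)‖ ≤ 2 * M * C₀ := hXdiff m hm m' hm'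
    have hv1 : ∀ σ : K →ₐ[ℚ] ℂ, ‖σ (v : K)‖ ≤ 2 * M ^ 2 * T * C₀ := hAdiff n hn n' hn'
    have h1 : ∀ σ : K →ₐ[ℚ] ℂ, ‖σ (u : K)‖ ≤ (M : ℝ) ^ 2 * C₁ := by
      intro σ
      refine (hu1 σ).trans ?_
      have : 2 * (M : ℝ) * C₀ ≤ (M : ℝ) ^ 2 * (2 * C₀) := by nlinarith
      refine this.trans ?_
      rw [hC₁]
      nlinarith [sq_nonneg C₀, mul_nonneg hT0 hC₀, sq_nonneg (M : ℝ)]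
    have h2 : ∀ σ : K →ₐ[ℚ] ℂ, ‖σ (v : K)‖ ≤ (M : ℝ) ^ 2 * C₁ := by
      intro σ
      refine (hv1 σ).trans ?_
      rw [hC₁]
      nlinarith [sq_nonneg C₀, mul_nonneg hT0 hC₀, sq_nonneg (M : ℝ), hC₀]
    have h3 : ∀ σ : K →ₐ[ℚ] ℂ, ‖σ ((u ^ 2 - v : 𝓞 K) : K)‖ ≤ (M : ℝ) ^ 2 * C₁ := by
      intro σ
      have hsplit : σ ((u ^ 2 - v : 𝓞 K) : K) = (σ (u : K)) ^ 2 - σ (v : K) := by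
        show σ (algebraMap (𝓞 K) K (u ^ 2 - v)) =
          σ (algebraMap (𝓞 K) K u) ^ 2 - σ (algebraMap (𝓞 K) K v)
        rw [map_sub, map_pow, map_sub, map_pow]
      rw [hsplit]
      have hx2 : ‖(σ (u : K)) ^ 2‖ ≤ (2 * M * C₀) ^ 2 := by
        rw [norm_pow]
        exact pow_le_pow_left₀ (norm_nonneg _) (hu1 σ) 2
      refine (norm_sub_le _ _).trans ((add_le_add hx2 (hv1 σ)).trans ?_)
      rw [hC₁]
      nlinarith [sq_nonneg C₀, mul_nonneg hT0 hC₀, sq_nonneg (M : ℝ), hC₀,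
        mul_nonneg (sq_nonneg (M : ℝ)) hC₀]
    exact ⟨natAbs_norm_lt_of_forall_le K _ h3 hwin, natAbs_norm_lt_of_forall_le K _ h1 hwin,
      natAbs_norm_lt_of_forall_le K _ h2 hwin⟩
  -- the abstract lift
  obtain ⟨S, hcount, hsrs⟩ := traceZeroLift φ (ZMod.ringHom_surjective φ) X A hA hN
  refine ⟨S, ?_, hsrs⟩
  rwa [hcardX, hcardA] at hcount

end Summit.MatrixMultiplication.MatrixMultiplication.Theorems.LevelOneGL2Designs.TraceZeroLift
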